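import Literature.Geometry.Riemannian.EellsSampsonProofs
import Literature.Geometry.Riemannian.HarmonicMapTensionField
import Literature.Geometry.Riemannian.RiemannianMetricComap
import Literature.Geometry.Manifold.WhitneyApproximation
import Literature.Topology.FourManifolds.InteriorManifold
import Literature.Geometry.Manifold.ModelChange
import HarnessLib

/-!
# Eells–Sampson: reduction to sources charted on `ℝ^m` and to the solvability of `τ(φ) = 0`
(topic `Geometry/Riemannian`)

The named fact `eellsSampson_existence` (`EellsSampson.lean`; Eells–Sampson 1964, §11 Thm.;
Carlson–Müller-Stach–Peters 2017, Thm. 14.1.3) asserts that every continuous map from a compact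
Riemannian manifold `(M, g)` (any boundaryless model with corners on a finite-dimensional space)
into a compact Riemannian manifold `(N, h)` of nonpositive sectional curvature is homotopic to a
harmonic map (`IsHarmonicMap`, the variational notion). This file PROVES two reductions:

* `eellsSampson_existence_of_euclideanModel` — it suffices to treat sources charted on
  `EuclideanSpace ℝ (Fin m)` (model `𝓡 m`): transport along the identity diffeomorphism
  `Θ : M ≅ Rechart toEuclidean (InteriorManifold IM M)` (`InteriorManifold.lean`,
  `ModelChange.lean`), with the pulled-back metric `riemannianComap g Θ⁻¹` and
  `isHarmonicMap_comp_iff` (`RiemannianMetricComap.lean`: naturality of the energy density and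
  isometry invariance of the Riemannian measure, `RiemannianMeasureIsometry.lean`);
* `eellsSampson_existence_of_tensionField_solvable` — **the fact follows from the solvability of
  the harmonic map equation `τ(φ) = 0` in every smooth homotopy class** of maps from compact
  `ℝ^m`-charted Riemannian manifolds into compact Riemannian manifolds of nonpositive curvature
  (the analytic theorem of Eells–Sampson 1964, §§6–10: the heat flow `∂ₜu = τ(u)` exists for all
  time and subconverges to such a `φ`), by Whitney approximation (`exists_contMDiff_homotopic`,
  `WhitneyApproximation.lean`) and `τ(φ) ≡ 0 ⇒ IsHarmonicMap`
  (`isHarmonicMap_of_tensionField_eq_zero`, the first-variation formula on closed manifolds,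
  `EnergyFirstVariation.lean`).

Thus the differential-geometric, variational and topological layers of the Eells–Sampson
theorem are in the tree, and what remains of the named fact is exactly the displayed analytic
hypothesis (in local coordinates the semilinear system of `TensionFieldCoordinates.lean`).
Everything is proved; there are no definitions and no named facts.

## References

* J. Eells, J. H. Sampson, *Harmonic mappings of Riemannian manifolds*, Amer. J. Math. 86 (1964),
  §§6–11. [EellsSampson1964]
* J. Carlson, S. Müller-Stach, C. Peters, *Period Mappings and Period Domains*, 2nd ed. (2017),
  §14.1, Thm. 14.1.3. [CarlsonMullerStachPeters2017]
* J. M. Lee, *Introduction to Smooth Manifolds*, 2nd ed. (2013), Thm. 6.26. [LeeSmoothManifolds2013]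
-/

noncomputable section

open Bundle Set Function Filter
open scoped Manifold ContDiff Topology

namespace Literature.Geometry.Riemannian

open Lorentzian Lorentzian.PseudoRiemannianMetric HarmonicMap
open Literature.Topology.FourManifolds Literature.Geometry.Manifold

/-- **The Eells–Sampson theorem reduces to sources charted on `ℝ^m`.** If every continuous map
from a compact `C^∞` manifold `M` charted on `EuclideanSpace ℝ (Fin m)` (model `𝓡 m`, no
boundary), carrying any `C^∞` Riemannian metric, into a compact Riemannian manifold of
nonpositive sectional curvature is homotopic to a harmonic map, then the same holds for sources
over an arbitrary boundaryless model with corners on a finite-dimensional space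
(`eellsSampson_existence`). Proof: along the identity diffeomorphism
`Θ : M ≅ Rechart toEuclidean (InteriorManifold IM M) = M₁` transport the metric
(`riemannianComap` along `Θ⁻¹`), apply the hypothesis on `M₁` to `f ∘ Θ⁻¹`, and transport the
harmonic map back (`isHarmonicMap_comp_iff`: energies of corresponding deformations agree, by
naturality of the energy density and invariance of the Riemannian measure under the isometry
`Θ⁻¹`). [cite: CarlsonMullerStachPeters2017, §14.1, Thm. 14.1.3] -/
theorem eellsSampson_existence_of_euclideanModel
    (H : ∀ (m : ℕ) (M : Type) [TopologicalSpace M] [ChartedSpace (EuclideanSpace ℝ (Fin m)) M]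
      [IsManifold (𝓡 m) ∞ M] [CompactSpace M] [T3Space M] [MeasurableSpace M] [BorelSpace M]
      (EN : Type) [NormedAddCommGroup EN] [NormedSpace ℝ EN] [FiniteDimensional ℝ EN]
      [CompleteSpace EN] (HN : Type) [TopologicalSpace HN] (IN : ModelWithCorners ℝ EN HN)
      (N : Type) [TopologicalSpace N] [ChartedSpace HN N] [IsManifold IN ∞ N]
      [BoundarylessManifold IN N] [T2Space N] [CompactSpace N]
      (g : ContMDiffRiemannianMetric (𝓡 m) ∞ (EuclideanSpace ℝ (Fin m))
        (TangentSpace (𝓡 m) : M → Type _))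
      (h : PseudoRiemannianMetric IN ∞ EN (TangentSpace IN : N → Type _)),
      h.IsRiemannian → h.HasNonposSectionalCurvature →
        ∀ f : C(M, N), ∃ (φ : M → N) (hφ : IsHarmonicMap g h φ),
          f.Homotopic ⟨φ, hφ.continuous⟩) :
    eellsSampson_existence := by
  intro EM _ _ _ HM _ IM M _ _ _ _ _ _ _ _ EN _ _ _ _ HN _ IN N _ _ _ _ _ _ g h hR hK f
  -- ### `M` is its own interior, a manifold charted on `EM`, recharted on `ℝ^{dim EM}`
  let Φ : M ≃ₜ InteriorManifold IM M :=
    { toFun := fun x => ⟨x, BoundarylessManifold.isInteriorPoint (I := IM)⟩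
      invFun := InteriorManifold.val
      left_inv := fun _ => rfl
      right_inv := fun _ => rfl
      continuous_toFun := InteriorManifold.continuous_iff_comp_val.2 continuous_id
      continuous_invFun := InteriorManifold.continuous_val }
  haveI : CompactSpace (InteriorManifold IM M) := Φ.compactSpace
  set m := Module.finrank ℝ EM with hm
  let L : EM ≃L[ℝ] EuclideanSpace ℝ (Fin m) := toEuclidean
  have hIf : ∀ x : EM, L.toHomeomorph x = L (𝓘(ℝ, EM) x) := fun x => rfl
  have hL : ContMDiff 𝓘(ℝ, EM) 𝓘(ℝ, EuclideanSpace ℝ (Fin m)) ∞ L.toHomeomorph :=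
    Rechart.contMDiff_of_apply_eq_linear (I := 𝓘(ℝ, EM)) L.toHomeomorph L hIf
  have hL' : ContMDiff 𝓘(ℝ, EuclideanSpace ℝ (Fin m)) 𝓘(ℝ, EM) ∞ L.toHomeomorph.symm :=
    Rechart.contMDiff_symm_of_apply_eq_linear (I := 𝓘(ℝ, EM)) L.toHomeomorph L hIf
  haveI hM₁ : IsManifold 𝓘(ℝ, EuclideanSpace ℝ (Fin m)) ∞
      (Rechart L.toHomeomorph (InteriorManifold IM M)) :=
    Rechart.isManifold L.toHomeomorph (InteriorManifold IM M) hL hL'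
  -- ### the identity homeomorphism `Θ : M ≃ₜ M₁` and its smoothness in both directions
  let Θ : M ≃ₜ Rechart L.toHomeomorph (InteriorManifold IM M) :=
    Φ.trans (Rechart.outHomeomorph L.toHomeomorph (InteriorManifold IM M)).symm
  have hΨ : ContMDiff 𝓘(ℝ, EuclideanSpace ℝ (Fin m)) IM ∞
      (Θ.symm : Rechart L.toHomeomorph (InteriorManifold IM M) → M) :=
    (InteriorManifold.contMDiff_val (I := IM) (M := M)).comp
      (Rechart.contMDiff_out L.toHomeomorph (InteriorManifold IM M) hL hL')
  have hΦs : ContMDiff IM 𝓘(ℝ, EM) ∞ (Φ : M → InteriorManifold IM M) :=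
    InteriorManifold.contMDiff_iff_comp_val.2 contMDiff_id
  have hΨ' : ContMDiff IM 𝓘(ℝ, EuclideanSpace ℝ (Fin m)) ∞
      (Θ : M → Rechart L.toHomeomorph (InteriorManifold IM M)) :=
    (Rechart.contMDiff_into L.toHomeomorph (InteriorManifold IM M) hL hL').comp hΦs
  have hleft : LeftInverse (Θ : M → _) (Θ.symm : _ → M) := Θ.apply_symm_apply
  have hright : RightInverse (Θ : M → _) (Θ.symm : _ → M) := Θ.symm_apply_apply
  -- the differential of `Θ⁻¹` is injective (it has the differential of `Θ` as left inverse)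
  have hinj : ∀ y, Function.Injective (mfderiv 𝓘(ℝ, EuclideanSpace ℝ (Fin m)) IM Θ.symm y) := by
    intro y v w hvw
    have hd : MDifferentiableAt 𝓘(ℝ, EuclideanSpace ℝ (Fin m)) IM Θ.symm y :=
      (hΨ y).mdifferentiableAt (by simp)
    have hd' : MDifferentiableAt IM 𝓘(ℝ, EuclideanSpace ℝ (Fin m)) Θ (Θ.symm y) :=
      (hΨ' (Θ.symm y)).mdifferentiableAt (by simp)
    have hcomp := mfderiv_comp y hd' hd
    have hid : mfderiv 𝓘(ℝ, EuclideanSpace ℝ (Fin m)) 𝓘(ℝ, EuclideanSpace ℝ (Fin m))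
        ((Θ : M → _) ∘ (Θ.symm : _ → M)) y = ContinuousLinearMap.id ℝ _ := by
      have : (Θ : M → _) ∘ (Θ.symm : _ → M) = id := funext hleft
      rw [this, mfderiv_id]
    have key : ∀ u, mfderiv IM 𝓘(ℝ, EuclideanSpace ℝ (Fin m)) Θ (Θ.symm y)
        (mfderiv 𝓘(ℝ, EuclideanSpace ℝ (Fin m)) IM Θ.symm y u) = u := fun u ↦
      DFunLike.congr_fun (hcomp.symm.trans hid) u
    rw [← key v, ← key w, hvw]
  have hdim : Module.finrank ℝ (EuclideanSpace ℝ (Fin m)) = Module.finrank ℝ EM := by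
    rw [finrank_euclideanSpace, Fintype.card_fin]
  -- ### instances on `M₁` and the transported metric
  haveI : T3Space (Rechart L.toHomeomorph (InteriorManifold IM M)) := Θ.t3Space
  letI : MeasurableSpace (Rechart L.toHomeomorph (InteriorManifold IM M)) := borel _
  haveI : BorelSpace (Rechart L.toHomeomorph (InteriorManifold IM M)) := ⟨rfl⟩
  set g₁ := riemannianComap g Θ.symm (hΨ.of_le (by exact_mod_cast (le_top : (⊤ : ℕ∞) + 1 ≤ ⊤)))
    hinj hdim with hg₁
  -- ### the hypothesis on `M₁`, transported back along `Θ`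
  obtain ⟨φ₁, hφ₁, hhom⟩ := H m (Rechart L.toHomeomorph (InteriorManifold IM M)) EN HN IN N g₁ h
    hR hK (f.comp (Θ.symm : C(Rechart L.toHomeomorph (InteriorManifold IM M), M)))
  have hφ : IsHarmonicMap g h (φ₁ ∘ Θ) := by
    rw [← isHarmonicMap_comp_iff g h hΨ hΨ' hleft hright hinj hdim (φ := φ₁ ∘ Θ)]
    have : (φ₁ ∘ Θ) ∘ (Θ.symm : _ → M) = φ₁ := funext fun y ↦ by simp [hleft y]
    rw [this]
    exact hφ₁
  refine ⟨φ₁ ∘ Θ, hφ, ?_⟩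
  have hcomp := hhom.comp (ContinuousMap.Homotopic.refl
    (Θ : C(M, Rechart L.toHomeomorph (InteriorManifold IM M))))
  rw [ContinuousMap.comp_assoc, Homeomorph.symm_comp_toContinuousMap, ContinuousMap.comp_id]
    at hcomp
  exact hcomp

/-- **The Eells–Sampson theorem reduces to the solvability of the harmonic map equation in each
smooth homotopy class, for sources charted on `ℝ^m`.** Suppose that for every compact `C^∞`
manifold `M` charted on `EuclideanSpace ℝ (Fin m)` (no boundary) with a `C^∞` Riemannian metric
`g`, every compact manifold `N` without boundary with a `C^∞` Riemannian metric `h` of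
nonpositive sectional curvature, and every `C^∞` map `f : M → N`, there is a `C^∞` map `φ`
homotopic to `f` with vanishing tension field `τ(φ) ≡ 0` — the analytic content of Eells–Sampson
1964 (§§6–10: global existence of the heat flow `∂ₜu = τ(u)` from `f` and convergence of
`u(tₖ, ·)` to such a `φ`). Then `eellsSampson_existence` holds: by Whitney approximation
(`exists_contMDiff_homotopic`) `f` may be taken `C^∞`; `τ(φ) ≡ 0` gives `IsHarmonicMap`
(`isHarmonicMap_of_tensionField_eq_zero`, the first-variation formula on closed manifolds); and
arbitrary source models reduce to `ℝ^m` (`eellsSampson_existence_of_euclideanModel`).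
[cite: EellsSampson1964, §§6–10 and §11 Thm.] [cite: CarlsonMullerStachPeters2017, §14.1, Thm. 14.1.3] -/
theorem eellsSampson_existence_of_tensionField_solvable
    (H : ∀ (m : ℕ) (M : Type) [TopologicalSpace M] [ChartedSpace (EuclideanSpace ℝ (Fin m)) M]
      [IsManifold (𝓡 m) ∞ M] [CompactSpace M] [T3Space M] [MeasurableSpace M] [BorelSpace M]
      (EN : Type) [NormedAddCommGroup EN] [NormedSpace ℝ EN] [FiniteDimensional ℝ EN]
      [CompleteSpace EN] (HN : Type) [TopologicalSpace HN] (IN : ModelWithCorners ℝ EN HN)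
      (N : Type) [TopologicalSpace N] [ChartedSpace HN N] [IsManifold IN ∞ N]
      [BoundarylessManifold IN N] [T2Space N] [CompactSpace N]
      (g : ContMDiffRiemannianMetric (𝓡 m) ∞ (EuclideanSpace ℝ (Fin m))
        (TangentSpace (𝓡 m) : M → Type _)) [(ofRiemannian g).HasLeviCivita]
      (h : PseudoRiemannianMetric IN ∞ EN (TangentSpace IN : N → Type _)) [h.HasLeviCivita],
      h.IsRiemannian → h.HasNonposSectionalCurvature →
        ∀ (f : M → N) (hf : ContMDiff (𝓡 m) IN ∞ f),
          ∃ φ : M → N, ∃ hφ : ContMDiff (𝓡 m) IN ∞ φ, (∀ x, tensionField g h φ x = 0) ∧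
            (⟨f, hf.continuous⟩ : C(M, N)).Homotopic ⟨φ, hφ.continuous⟩) :
    eellsSampson_existence := by
  refine eellsSampson_existence_of_euclideanModel fun m M _ _ _ _ _ _ _ EN _ _ _ _ HN _ IN N _ _ _
    _ _ _ g h hR hK f ↦ ?_
  haveI : (ofRiemannian g).HasLeviCivita := (ofRiemannian g).hasLeviCivita
  haveI : h.HasLeviCivita := h.hasLeviCivita
  -- Whitney approximation: `f` is homotopic to a `C^∞` map `ψ`
  obtain ⟨ψ, hψ, hfψ⟩ := exists_contMDiff_homotopic (IM := 𝓡 m) (IN := IN) f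
  -- the analytic hypothesis: a solution of `τ = 0` homotopic to `ψ`
  obtain ⟨φ, hφ, hτ, hψφ⟩ := H m M EN HN IN N g h hR hK ψ hψ
  have hharm : IsHarmonicMap g h φ := isHarmonicMap_of_tensionField_eq_zero h g hφ hτ
  refine ⟨φ, hharm, ?_⟩
  have hψeq : (⟨ψ, hψ.continuous⟩ : C(M, N)) = ψ := by ext; rfl
  rw [hψeq] at hψφ
  exact hfψ.trans hψφ

end Literature.Geometry.Riemannian

end
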